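import Summits.CriticalPhenomena.PercolationContinuityZ3.Theorems.Transplant.BoxProdZ2SummitUnfolded
import Summits.CriticalPhenomena.PercolationContinuityZ3.Theorems.Transplant.BoxProdZ2ZdInstance
import HarnessLib

/-!
# The PRODUCT-NODE headline in Mathlib vocabulary — the proved instance `X = ℤ` (`ℤ □ ℤ² ≅ ℤ³`)

builds on p205010 (kernel theorem, internal audit signed; external expert review pending).
Sibling of `Transplant/BoxProdZ2SummitUnfolded.lean` (lead g3 assignment, hp-8 g20): the unfolded conclusion of
`BSConj4_boxProdZ2_unfolded` at `X = hasse(ℤ) = zdGraph 1`, root `(0, 0)`, is a THEOREM of the tree — the transport of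
`θ_{ℤ³}(p_c) = 0` along `ℤ □ ℤ² ≃g ℤ³` (`theta_zdGraph_boxProdZ2_ownCritical_eq_zero`, `Transplant/BoxProdZ2ZdInstance.lean`) —
and `X = hasse(ℤ)` lies in the conjecture's class (connected, quasi-transitive in the unfolded sense, `ℤ` infinite).  So the unfolded
family quantifies over a class with at least one member where its conclusion is already kernel-checked.  (Kept in a separate file so
that the certificate `bsConj4_boxProdZ2_unfolded_iff` imports `StatementBoxProdZ2` only; the box product is written
`SimpleGraph.boxProd` here because an import of this file overloads the `□ ` notation.)
[cite: BenjaminiSchramm1996, Conj. 4] [cite: KozmaNitzan2024, Thm. 6 with Conj. 3 (p. 15)]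
-/

noncomputable section

namespace Summit.CriticalPhenomena.PercolationContinuityZ3.Theorems.Transplant

namespace BoxProdZ2SummitAudit

open MeasureTheory ProbabilityTheory Literature.Probability.Percolation Literature.Probability.LatticeModels
open scoped ProbabilityTheory

/-- **The instance `X = ℤ` of the unfolded product headline is a theorem**: for `G = hasse(ℤ) □ hasse(ℤ²)` (`≅ ℤ³`) rooted at
`(0, 0)`, `θ_G(p_c(G)) = 0`, every project definition unfolded (closed by `theta_zdGraph_boxProdZ2_ownCritical_eq_zero 1 0`, i.e. by
p205010's `θ_{ℤ³}(p_c) = 0` transported along `ℤ □ ℤ² ≃g ℤ³`). [cite: KozmaNitzan2024, Thm. 6 with Conj. 3 (p. 15)] -/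
theorem boxProdAudit_instance_Z_unfolded :
    (setBer((SimpleGraph.boxProd (SimpleGraph.hasse (Fin 1 → ℤ)) (SimpleGraph.hasse (Fin 2 → ℤ))).edgeSet,
        (⟨sInf ({p : ℝ | ∃ h : p ∈ unitInterval,
              0 < (setBer((SimpleGraph.boxProd (SimpleGraph.hasse (Fin 1 → ℤ)) (SimpleGraph.hasse (Fin 2 → ℤ))).edgeSet,
                      (⟨p, h⟩ : unitInterval))).real
                {ω : Set (Sym2 ((Fin 1 → ℤ) × (Fin 2 → ℤ))) |
                  {y : (Fin 1 → ℤ) × (Fin 2 → ℤ) |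
                    (SimpleGraph.fromEdgeSet ω).Reachable ((0 : Fin 1 → ℤ), (0 : Fin 2 → ℤ)) y}.Infinite}} ∪ {1}),
          (criticalProbIOf (SimpleGraph.boxProd (zdGraph 1) (zdGraph 2)) ((0 : Site 1), (0 : Site 2))).2⟩ : unitInterval))).real
      {ω : Set (Sym2 ((Fin 1 → ℤ) × (Fin 2 → ℤ))) |
        {y : (Fin 1 → ℤ) × (Fin 2 → ℤ) |
          (SimpleGraph.fromEdgeSet ω).Reachable ((0 : Fin 1 → ℤ), (0 : Fin 2 → ℤ)) y}.Infinite} = 0 :=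
  theta_zdGraph_boxProdZ2_ownCritical_eq_zero 1 0

/-- `X = hasse(ℤ)` lies in the conjecture's class, hypotheses unfolded: connected, quasi-transitive (orbit representatives: one
vertex), `ℤ` infinite (tree `boxProdZ2_zd_in_scope 1`). [cite: BenjaminiSchramm1996, Conj. 4 and §2] -/
theorem boxProdAudit_instance_Z_in_scope :
    (SimpleGraph.hasse (Fin 1 → ℤ)).Connected ∧
      (∃ V₀ : Finset (Fin 1 → ℤ), ∀ v, ∃ γ : SimpleGraph.hasse (Fin 1 → ℤ) ≃g SimpleGraph.hasse (Fin 1 → ℤ), γ v ∈ V₀) ∧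
      Infinite (Fin 1 → ℤ) :=
  boxProdZ2_zd_in_scope 1 le_rfl

/-- Hence the unfolded conjecture, once proved, is consistent with (indeed extends) the audited `ℤ³` theorem: its instance at
`X = hasse(ℤ)`, `w = 0` is literally `boxProdAudit_instance_Z_unfolded`. [cite: BenjaminiSchramm1996, Conj. 4] -/
theorem bsConj4_boxProdZ2_unfolded_instance_Z (h : BSConj4_boxProdZ2_unfolded) :
    (setBer((SimpleGraph.boxProd (SimpleGraph.hasse (Fin 1 → ℤ)) (SimpleGraph.hasse (Fin 2 → ℤ))).edgeSet,
        (⟨sInf ({p : ℝ | ∃ h : p ∈ unitInterval,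
              0 < (setBer((SimpleGraph.boxProd (SimpleGraph.hasse (Fin 1 → ℤ)) (SimpleGraph.hasse (Fin 2 → ℤ))).edgeSet,
                      (⟨p, h⟩ : unitInterval))).real
                {ω : Set (Sym2 ((Fin 1 → ℤ) × (Fin 2 → ℤ))) |
                  {y : (Fin 1 → ℤ) × (Fin 2 → ℤ) |
                    (SimpleGraph.fromEdgeSet ω).Reachable ((0 : Fin 1 → ℤ), (0 : Fin 2 → ℤ)) y}.Infinite}} ∪ {1}),
          (criticalProbIOf (SimpleGraph.boxProd (zdGraph 1) (zdGraph 2)) ((0 : Site 1), (0 : Site 2))).2⟩ : unitInterval))).real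
      {ω : Set (Sym2 ((Fin 1 → ℤ) × (Fin 2 → ℤ))) |
        {y : (Fin 1 → ℤ) × (Fin 2 → ℤ) |
          (SimpleGraph.fromEdgeSet ω).Reachable ((0 : Fin 1 → ℤ), (0 : Fin 2 → ℤ)) y}.Infinite} = 0 :=
  h (SimpleGraph.hasse (Fin 1 → ℤ)) boxProdAudit_instance_Z_in_scope.1 boxProdAudit_instance_Z_in_scope.2.1
    boxProdAudit_instance_Z_in_scope.2.2 0

end BoxProdZ2SummitAudit

end Summit.CriticalPhenomena.PercolationContinuityZ3.Theorems.Transplant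

end
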